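import Summits.CriticalPhenomena.CardyFormulaZ2.Theses.CardyBondTriangular

/-!
# Route item `IsoAnchorGlue` (stmt-CriticalPhenomena-4669) — cross-route glue to `CardyIsoradial.IsoAnchor`

Support item of route `CardyBondTriangular` (sub-problem `CardyFormulaZ2`):
`BondTriangularCardy → TriIsoradialInstance → IsoAnchor`, where `IsoAnchor` (route
`CardyIsoradial`'s anchor crux, stmt-CriticalPhenomena-0786) is inlined verbatim in the item:
the existence of SOME isoradially embedded graph in Grimmett–Manolescu's class 𝒢 (preconnected,
isoradial, rhombic tiling, square-grid property, bounded angles) whose canonical bond percolation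
satisfies Cardy's formula for every conformal rectangle in the crude discretisation
`embDomainCrossing`.

The proof is pure logic: instantiate the existential with `V = Site 2`, `F = HexVertex`,
`G = triGraph`, the rhombic embedding `emb` supplied by `TriIsoradialInstance`, and `ε = π/6`;
the crossing-limit clause is `BondTriangularCardy` after rewriting the canonical law
`emb.isoradialPercolation = bondPercolation triGraph (criticalWeightI (π/6))` and the embedding
`emb.z = fun x ↦ √3 · (triEmbed x − (1 + ζ)/3)`.
-/

namespace Summit.CriticalPhenomena.CardyFormulaZ2.Theorems

open Literature.Probability.LatticeModels

/-- **Cross-route glue (route item `IsoAnchorGlue`, stmt-CriticalPhenomena-4669).**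
If canonical bond percolation on the triangular lattice `𝕋` (edge weight
`criticalWeightI (π/6) = 2 sin (π/18)`, embedding `z x = √3 (triEmbed x − (1+ζ)/3)`) satisfies
Cardy's formula for every conformal rectangle (`BondTriangularCardy`), and `𝕋` with this embedding
is a member of 𝒢 whose canonical law is that bond percolation (`TriIsoradialInstance`), then
route `CardyIsoradial`'s anchor statement `IsoAnchor` holds, witnessed by
`(Site 2, HexVertex, triGraph, emb, π/6)`. Pure logic (rewrite the law and the embedding). -/
theorem isoAnchorGlue_proof :
    Summit.CriticalPhenomena.CardyFormulaZ2.Theses.CardyBondTriangular.IsoAnchorGlue := by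
  unfold Summit.CriticalPhenomena.CardyFormulaZ2.Theses.CardyBondTriangular.IsoAnchorGlue
  intro hT hI
  obtain ⟨hpre, emb, hz, hiso, htile, hsgp, hbap, hlaw⟩ := hI
  refine ⟨Site 2, HexVertex, inferInstance, inferInstance, inferInstance, triGraph, inferInstance,
    emb, Real.pi / 6, hpre, hiso, htile, hsgp, by positivity, hbap, ?_⟩
  intro R
  rw [hlaw, hz]
  exact hT R

end Summit.CriticalPhenomena.CardyFormulaZ2.Theorems
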